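import Literature.MathematicalPhysics.QuantumFieldTheory.Balaban1983to89.Beta.LargeLWindow

/-!
# `Balaban1983to89.Beta.LeadingCoefficient` — β sub-cell row BETA-an3 (gen 3): the SIGN row (L5) of the lead's
(AF-0-L) road, closed in the kernel MODULO the shape rows (L1)–(L3): the continuum transverse one-loop structure
`T_{μν}(x) = 24·x_μ²x_ν²/|x|₂⁸` (`μ ≠ ν` entry of `x_μx_ν·(∂_μ∂_ν − δ_{μν}Δ)|x|₂⁻⁴` in `d = 4`) is a `HomogKernel`, its dyadic
lattice coefficient `I₁ = unitCoeff μ ν` EXISTS, is UNIQUE and is STRICTLY POSITIVE (`≥ 2⁻¹⁹`, crude by design), hence for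
the leading kernel `κ·T` the coefficient is `κ·I₁` and   (AF-0-L) ⟺ κ > 0   (`af0L_iff_pos`): the sign question of the whole
β sub-cell is the sign of ONE scalar `κ`, the one (L1)–(L3) must exhibit.

HONEST FRAMING (cell rule, verbatim): discharging `BetaPertH` makes Bałaban's UV stability UNCONDITIONAL — a real
constructive-QFT result; it is NOT the continuum limit and NOT the Clay problem.  THIS MODULE DISCHARGES NOTHING of the
series: it is elementary real analysis (a rational function on `ℝ⁴`, its restriction to `ℤ⁴`, finite sums) composed BY NAME
with the lead's kernel (`Beta.DyadicShell`, `Beta.WindowLog`, `Beta.LargeLWindow`, `Beta.LargeL`).  Every statement about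
Bałaban's `β⁰_{k+1}(L)` below carries the hypothesis `WindowDecomposition β0 (κ·T∘toReal) …` as an explicit binder and is
asserted of nothing.  Value = the typed (L5) closure + the typed VALUE/TRANSFER dictionary, NOT summit progress (audit cell
`pub-balaban`, β sub-cell row BETA-an3, unit `b2b-balaban-beta-an3` gen 3; prose companion
`run/shared/lean/pub/pub-balaban/BETA/AN3.md` v3 §6; spec `BETA-SPEC.md` v1.8 §8.6 (k)(m)(p)).

ABSOLUTE RULE (cell, verbatim): "a printed β-function coefficient from a DIFFERENT scheme is citable only together with a
proved transfer statement."  Nothing below imports a coefficient.  The printed number enters only through the tree constant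
`B12Normalization.stepBal N L = (11N²/12π²)·log L` in ONE arithmetic identity (`slope_kappaBal`: the scalar
`kappaBal N := 11N²/(24π⁴)` is BY DEFINITION the `κ` whose slope `2π²κ` equals `stepBal N L / log L`); whether Bałaban's
leading kernel has `κ = kappaBal N` is the located, UNPRINTED identification (cell GAPS G-beta-an3-4, rows (L1)–(L3) +
BETA-an3 §6) and is asserted nowhere.  The continuum value `∫_{1<‖x‖_∞≤2} T = 2π²·log 2` (`transverseValue`) is a DEFINED
real number used only inside hypothesis binders (`hval`); it is proved on paper and reproduced numerically in AN3.md v3 §6,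
not in the kernel.

CITATION HEADER (lean-in-tree rule 2026-08-18).  (B12) T. Bałaban, *Renormalization group approach to lattice gauge field
theories. I*, Commun. Math. Phys. **109**, 249–301 (1987) [Balaban1987RG1], (1.22) p. 264, verbatim: «β_{j+1}(g_j) =
−(∂²/∂p_1∂p_2 Π̃_{j+1,12})(g_j,0) = −(∂²/∂p_μ∂p_ν Π̃_{j+1,μν})(g_j,0) = Σ_x Π_{j+1,μν}(g_j,x)x_μx_ν (1.22) for μ, ν arbitrary,
μ ≠ ν» — this fixes WHICH functional the shapes are about (a second moment with `μ ≠ ν`, no sum over `μ, ν`) and is the only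
use of the source; nothing printed is asserted.  The (AF-0-L) target, the window decomposition and Theorem 2's inputs are
the lead's typed shapes (`Beta.LargeL`, `Beta.LargeLWindow`), cited there.

WHAT THIS MODULE DOES (all `[folklore]`; constants crude by design).
* §1 `normSq` (`|x|₂²` on `ℝ⁴ = Fin 4 → ℝ` with Mathlib's SUP norm `‖·‖`): `‖x‖² ≤ |x|₂² ≤ 4‖x‖²`, scaling.
* §2 THE STRUCTURE `transverseUnit μ ν x = 24(x_μx_ν)²/|x|₂⁸` and `leadingIntegrand κ μ ν = κ·transverseUnit μ ν`:
  nonnegative, degree `−4` homogeneous, `≤ 24` on the unit sup-sphere, `110592`-Lipschitz on the shell `1/2 ≤ ‖x‖ ≤ 2`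
  ⇒ `HomogKernel (transverseUnit μ ν) 24 110592` (`homogKernel_transverseUnit`).
* §3 THE SIGN: `transverseUnit ≥ 1/2048` on the cube `x₀ + [0,1/2]⁴`, `x₀ = (5/4 at μ, ν; 0 elsewhere)` inside the open
  shell ⇒ (`DyadicShell.coeff_pos_of_cube`) the dyadic coefficient `unitCoeff μ ν` of `T∘toReal` satisfies
  `2⁻¹⁹ ≤ unitCoeff μ ν`, `0 < unitCoeff μ ν`; it is the unique limit (`unitCoeff_unique`); for `κ·T` the coefficient is
  `κ·unitCoeff μ ν` (`dyadicRate_leadingIntegrand`, `coeff_eq_mul`) and its sign is the sign of `κ` (`coeff_pos_iff` &c.).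
* §4 CONSUMERS modulo (L1)–(L3): from `W : WindowDecomposition β0 (fun w => leadingIntegrand κ μ ν (toReal w)) Ch Cg A₁ c M`
  — `κ ≥ 0` ⇒ `LogGrowthLower β0 (κ·I₁/log 2) A(κ·I₁)`; `κ > 0` + the printed-type inputs ⇒ Theorem 2 as printed /
  endpoint existence (`thm2Printed_of_window`, `endpointExistence_of_window` = `LargeLWindow.thm2Printed` ∘ §3);
  `κ ≤ 0` ⇒ `β0 L k ≤ 160·Cg + A₁` uniformly — NO logarithmic growth (`upper_of_nonpos`); and the DICHOTOMY
  `(∃ b > 0, ∃ A, LogGrowthLower β0 b A) ↔ 0 < κ` (`af0L_iff_pos`).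
* §5 VALUE / TRANSFER DICTIONARY (definitions + arithmetic only): `transverseValue := 2π²·log 2`,
  `kappaBal N := 11N²/(24π⁴)`, `slope_kappaBal : kappaBal N · transverseValue / log 2 · log L = stepBal N L`, and the
  consumer `logGrowthLower_of_value` turning the hypothesis `unitCoeff μ ν = transverseValue` into the slope `2π²κ`.
Mathlib + `Beta.LargeLWindow` only; no `sorry`, no `axiom`; the only `def`s are real numbers / real functions (no `Prop`).
-/

namespace Literature.MathematicalPhysics.QuantumFieldTheory.Balaban1983to89.Beta.LeadingCoefficient

open Literature.Probability.LatticeModels (annulus)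
open Literature.MathematicalPhysics.QuantumFieldTheory.Balaban1983to89
open Literature.MathematicalPhysics.QuantumFieldTheory.Balaban1983to89.FlowStep
open Literature.MathematicalPhysics.QuantumFieldTheory.Balaban1983to89.DagBinding
open Literature.MathematicalPhysics.QuantumFieldTheory.Balaban1983to89.FlowStepRuns
open Literature.MathematicalPhysics.QuantumFieldTheory.Balaban1983to89.Beta.Assembly
open Literature.MathematicalPhysics.QuantumFieldTheory.Balaban1983to89.Beta.RemainderChain
open Literature.MathematicalPhysics.QuantumFieldTheory.Balaban1983to89.Beta.AssemblyRemainder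
open Literature.MathematicalPhysics.QuantumFieldTheory.Balaban1983to89.Beta.LargeL (LogGrowthLower L₁ two_le_L₁
  div_le_log_of_L₁_le)
open Literature.MathematicalPhysics.QuantumFieldTheory.Balaban1983to89.Beta.WindowLog (dyadicBlock DyadicRate shellSum)
open Literature.MathematicalPhysics.QuantumFieldTheory.Balaban1983to89.Beta.DyadicShell (Pt DyadicData HomogKernel toReal
  toReal_apply dyadicData_of_homogKernel windowLog_of_homogKernel coeff_pos_of_cube dyadicRate_smul)
open Literature.MathematicalPhysics.QuantumFieldTheory.Balaban1983to89.Beta.LargeLWindow (WindowDecomposition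
  dyadicRate_unique)

noncomputable section

/-! ## 1. The Euclidean norm squared on `ℝ⁴` against Mathlib's sup norm -/

/-- `|x|₂² = Σ_i x_i²` on `ℝ⁴ = Fin 4 → ℝ`. [folklore] -/
def normSq (x : Fin 4 → ℝ) : ℝ := ∑ i, x i ^ 2

/-- `0 ≤ |x|₂²`. [folklore] -/
theorem normSq_nonneg (x : Fin 4 → ℝ) : 0 ≤ normSq x :=
  Finset.sum_nonneg fun i _ => sq_nonneg (x i)

/-- `x_i² ≤ |x|₂²`. [folklore] -/
theorem sq_le_normSq (x : Fin 4 → ℝ) (i : Fin 4) : x i ^ 2 ≤ normSq x :=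
  Finset.single_le_sum (f := fun j => x j ^ 2) (fun j _ => sq_nonneg (x j)) (Finset.mem_univ i)

/-- `|x_i| ≤ ‖x‖` (sup norm). [folklore] -/
theorem abs_apply_le_norm (x : Fin 4 → ℝ) (i : Fin 4) : |x i| ≤ ‖x‖ := by
  rw [← Real.norm_eq_abs]
  exact norm_le_pi_norm x i

/-- `‖x‖² ≤ |x|₂²`. [folklore] -/
theorem norm_sq_le_normSq (x : Fin 4 → ℝ) : ‖x‖ ^ 2 ≤ normSq x := by
  have h : ‖x‖ ≤ Real.sqrt (normSq x) := by
    refine (pi_norm_le_iff_of_nonneg (Real.sqrt_nonneg _)).mpr fun i => ?_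
    rw [Real.norm_eq_abs]
    exact Real.abs_le_sqrt (sq_le_normSq x i)
  calc ‖x‖ ^ 2 ≤ Real.sqrt (normSq x) ^ 2 := pow_le_pow_left₀ (norm_nonneg _) h 2
    _ = normSq x := Real.sq_sqrt (normSq_nonneg x)

/-- `|x|₂² ≤ 4‖x‖²`. [folklore] -/
theorem normSq_le (x : Fin 4 → ℝ) : normSq x ≤ 4 * ‖x‖ ^ 2 := by
  have h : ∀ i, x i ^ 2 ≤ ‖x‖ ^ 2 := fun i => by
    rw [← sq_abs]
    exact pow_le_pow_left₀ (abs_nonneg _) (abs_apply_le_norm x i) 2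
  calc normSq x = ∑ i, x i ^ 2 := rfl
    _ ≤ ∑ _i : Fin 4, ‖x‖ ^ 2 := Finset.sum_le_sum fun i _ => h i
    _ = 4 * ‖x‖ ^ 2 := by simp

/-- Scaling: `|t x|₂² = t²|x|₂²`. [folklore] -/
theorem normSq_smul (t : ℝ) (x : Fin 4 → ℝ) : normSq (t • x) = t ^ 2 * normSq x := by
  simp only [normSq, Pi.smul_apply, smul_eq_mul, mul_pow, Finset.mul_sum]

/-- `x ≠ 0 ⇒ 0 < |x|₂²`. [folklore] -/
theorem normSq_pos {x : Fin 4 → ℝ} (hx : x ≠ 0) : 0 < normSq x :=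
  lt_of_lt_of_le (pow_pos (norm_pos_iff.mpr hx) 2) (norm_sq_le_normSq x)

/-- On the shell `1/2 ≤ ‖x‖`: `1/4 ≤ |x|₂²`. [folklore] -/
theorem quarter_le_normSq {x : Fin 4 → ℝ} (hx : 1 / 2 ≤ ‖x‖) : 1 / 4 ≤ normSq x := by
  have h := norm_sq_le_normSq x
  nlinarith

/-- On the shell `‖x‖ ≤ 2`: `|x|₂² ≤ 16`. [folklore] -/
theorem normSq_le_sixteen {x : Fin 4 → ℝ} (hx : ‖x‖ ≤ 2) : normSq x ≤ 16 := by
  have h := normSq_le x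
  have h2 : ‖x‖ ^ 2 ≤ 4 := by nlinarith [norm_nonneg x]
  linarith

/-- Coordinates of a difference are bounded by the sup distance: `|x_i − y_i| ≤ ‖x − y‖`. [folklore] -/
theorem abs_sub_apply_le (x y : Fin 4 → ℝ) (i : Fin 4) : |x i - y i| ≤ ‖x - y‖ := by
  have := abs_apply_le_norm (x - y) i
  rwa [Pi.sub_apply] at this

/-- On the shell `‖x‖, ‖y‖ ≤ 2`: `||x|₂² − |y|₂²| ≤ 16‖x − y‖`. [folklore] -/
theorem abs_normSq_sub_le {x y : Fin 4 → ℝ} (hx : ‖x‖ ≤ 2) (hy : ‖y‖ ≤ 2) :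
    |normSq x - normSq y| ≤ 16 * ‖x - y‖ := by
  have hterm : ∀ i, |x i ^ 2 - y i ^ 2| ≤ 4 * ‖x - y‖ := by
    intro i
    have e : x i ^ 2 - y i ^ 2 = (x i - y i) * (x i + y i) := by ring
    have h1 := abs_sub_apply_le x y i
    have h2 : |x i + y i| ≤ 4 := by
      refine (abs_add_le _ _).trans ?_
      linarith [(abs_apply_le_norm x i).trans hx, (abs_apply_le_norm y i).trans hy]
    rw [e, abs_mul]
    calc |x i - y i| * |x i + y i| ≤ ‖x - y‖ * 4 :=
          mul_le_mul h1 h2 (abs_nonneg _) (norm_nonneg _)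
      _ = 4 * ‖x - y‖ := by ring
  have e : normSq x - normSq y = ∑ i, (x i ^ 2 - y i ^ 2) := by
    rw [normSq, normSq, ← Finset.sum_sub_distrib]
  rw [e]
  calc |∑ i, (x i ^ 2 - y i ^ 2)| ≤ ∑ i, |x i ^ 2 - y i ^ 2| := Finset.abs_sum_le_sum_abs _ _
    _ ≤ ∑ _i : Fin 4, 4 * ‖x - y‖ := Finset.sum_le_sum fun i _ => hterm i
    _ = 16 * ‖x - y‖ := by simp; ring

/-! ## 2. The transverse structure and the leading integrand; `HomogKernel (transverseUnit μ ν) 24 110592` -/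

/-- **THE UNIT TRANSVERSE SECOND-MOMENT INTEGRAND** for the pair `(μ, ν)`: `T(x) = 24·(x_μx_ν)²/|x|₂⁸` — for `μ ≠ ν` this
is `x_μx_ν·∂_μ∂_ν|x|₂⁻⁴ = x_μx_ν·(∂_μ∂_ν − δ_{μν}Δ)|x|₂⁻⁴` in `d = 4` (`∂_μ∂_ν|x|⁻⁴ = (24x_μx_ν − 4δ_{μν}|x|²)|x|⁻⁸`,
`Δ|x|⁻⁴ = 8|x|⁻⁶`), i.e. the (1.22)-integrand of the unit-normalised O(4)-covariant transverse degree-`−6` kernel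
`(∂_μ∂_ν − δ_{μν}Δ)|x|⁻⁴ = (24x_μx_ν − 12δ_{μν}|x|²)/|x|⁸` (the calculus identities are recorded, CAS-checked, in
AN3.md v3 §6; here `T` is DEFINED by the closed form; value `0` at `x = 0`). [folklore] -/
def transverseUnit (μ ν : Fin 4) (x : Fin 4 → ℝ) : ℝ := 24 * (x μ * x ν) ^ 2 / normSq x ^ 4

/-- **THE LEADING INTEGRAND with scalar `κ`**: `κ·T`.  The shape rows (L1)–(L3) are to deliver Bałaban's leading window
kernel `h` of `WindowDecomposition` in the form `h = (leadingIntegrand κ μ ν) ∘ toReal` for SOME real `κ` (BETA-SPEC v1.8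
§8.6 (p)); this module decides everything downstream as a function of the sign of `κ`. [folklore] -/
def leadingIntegrand (κ : ℝ) (μ ν : Fin 4) (x : Fin 4 → ℝ) : ℝ := κ * transverseUnit μ ν x

/-- `leadingIntegrand κ μ ν x = κ · transverseUnit μ ν x`. [folklore] -/
@[simp] theorem leadingIntegrand_apply (κ : ℝ) (μ ν : Fin 4) (x : Fin 4 → ℝ) :
    leadingIntegrand κ μ ν x = κ * transverseUnit μ ν x := rfl

/-- `T ≥ 0` everywhere. [folklore] -/
theorem transverseUnit_nonneg (μ ν : Fin 4) (x : Fin 4 → ℝ) : 0 ≤ transverseUnit μ ν x := by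
  unfold transverseUnit
  have := normSq_nonneg x
  positivity

/-- `T = 24·G²` with `G = x_μx_ν/|x|₂⁴`. [folklore] -/
theorem transverseUnit_eq_sq (μ ν : Fin 4) (x : Fin 4 → ℝ) :
    transverseUnit μ ν x = 24 * (x μ * x ν / normSq x ^ 2) ^ 2 := by
  unfold transverseUnit
  rw [div_pow]
  ring

/-- Degree `−4` homogeneity: `T(t x) = T(x)/t⁴` for `t > 0`, `x ≠ 0`. [folklore] -/
theorem transverseUnit_smul (μ ν : Fin 4) {t : ℝ} (ht : 0 < t) {x : Fin 4 → ℝ} (hx : x ≠ 0) :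
    transverseUnit μ ν (t • x) = transverseUnit μ ν x / t ^ 4 := by
  have hs : normSq x ≠ 0 := (normSq_pos hx).ne'
  have ht0 : t ≠ 0 := ht.ne'
  unfold transverseUnit
  rw [normSq_smul, Pi.smul_apply, Pi.smul_apply, smul_eq_mul, smul_eq_mul]
  field_simp

/-- `|x_μx_ν| ≤ |x|₂²` (`|x_μ|, |x_ν| ≤ ‖x‖` and `‖x‖² ≤ |x|₂²`; no `μ ≠ ν` needed). [folklore] -/
theorem abs_mul_apply_le_normSq (x : Fin 4 → ℝ) (μ ν : Fin 4) : |x μ * x ν| ≤ normSq x := by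
  rw [abs_mul]
  calc |x μ| * |x ν| ≤ ‖x‖ * ‖x‖ :=
        mul_le_mul (abs_apply_le_norm x μ) (abs_apply_le_norm x ν) (abs_nonneg _) (norm_nonneg _)
    _ = ‖x‖ ^ 2 := (sq ‖x‖).symm
    _ ≤ normSq x := norm_sq_le_normSq x

/-- Size on the unit sup-sphere: `‖x‖ = 1 ⇒ T(x) ≤ 24`. [folklore] -/
theorem transverseUnit_le_of_norm_eq_one (μ ν : Fin 4) {x : Fin 4 → ℝ} (hx : ‖x‖ = 1) :
    transverseUnit μ ν x ≤ 24 := by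
  have hs : 1 ≤ normSq x := by
    have := norm_sq_le_normSq x
    rwa [hx, one_pow] at this
  have hs0 : 0 < normSq x := by linarith
  have hm : |x μ * x ν| ≤ 1 := by
    rw [abs_mul]
    have h1 : |x μ| ≤ 1 := hx ▸ abs_apply_le_norm x μ
    have h2 : |x ν| ≤ 1 := hx ▸ abs_apply_le_norm x ν
    calc |x μ| * |x ν| ≤ 1 * 1 := mul_le_mul h1 h2 (abs_nonneg _) zero_le_one
      _ = 1 := one_mul _
  have hm2 : (x μ * x ν) ^ 2 ≤ 1 := by
    rw [← sq_abs]
    calc |x μ * x ν| ^ 2 ≤ 1 ^ 2 := pow_le_pow_left₀ (abs_nonneg _) hm 2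
      _ = 1 := one_pow _
  have hs4 : 1 ≤ normSq x ^ 4 := one_le_pow₀ hs
  unfold transverseUnit
  rw [div_le_iff₀ (by positivity)]
  nlinarith

/-- `|G(x)| ≤ 4` on the shell `1/2 ≤ ‖x‖` (`G = x_μx_ν/|x|₂⁴`, `|G| ≤ 1/|x|₂²`). [folklore] -/
theorem abs_G_le {x : Fin 4 → ℝ} (μ ν : Fin 4) (hx : 1 / 2 ≤ ‖x‖) : |x μ * x ν / normSq x ^ 2| ≤ 4 := by
  have hs := quarter_le_normSq hx
  have hs0 : 0 < normSq x := by linarith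
  rw [abs_div, abs_of_pos (pow_pos hs0 2), div_le_iff₀ (pow_pos hs0 2)]
  have hm := abs_mul_apply_le_normSq x μ ν
  have h1 : normSq x ≤ 4 * normSq x ^ 2 := by nlinarith
  linarith

/-- Lipschitz bound for `G = x_μx_ν/|x|₂⁴` on the shell `1/2 ≤ ‖·‖ ≤ 2`: `|G(x) − G(y)| ≤ 576‖x − y‖`
(`G(x) − G(y) = (x_μx_ν − y_μy_ν)/|x|⁴ + y_μy_ν(|y|² − |x|²)(|y|² + |x|²)/(|x|⁴|y|⁴)`, `|x_μx_ν − y_μy_ν| ≤ 4‖x − y‖`,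
`||x|² − |y|²| ≤ 16‖x − y‖`, `|y_μy_ν| ≤ |y|²`, `|x|², |y|² ≥ 1/4`). [folklore] -/
theorem abs_G_sub_G_le (μ ν : Fin 4) {x y : Fin 4 → ℝ} (hx1 : 1 / 2 ≤ ‖x‖) (hx2 : ‖x‖ ≤ 2) (hy1 : 1 / 2 ≤ ‖y‖)
    (hy2 : ‖y‖ ≤ 2) :
    |x μ * x ν / normSq x ^ 2 - y μ * y ν / normSq y ^ 2| ≤ 576 * ‖x - y‖ := by
  set δ : ℝ := ‖x - y‖ with hδ
  have hδ0 : 0 ≤ δ := norm_nonneg _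
  set s : ℝ := normSq x with hs_def
  set s' : ℝ := normSq y with hs'_def
  have hs : 1 / 4 ≤ s := quarter_le_normSq hx1
  have hs' : 1 / 4 ≤ s' := quarter_le_normSq hy1
  have hs0 : 0 < s := by linarith
  have hs0' : 0 < s' := by linarith
  -- numerator difference
  have hm : |x μ * x ν - y μ * y ν| ≤ 4 * δ := by
    have h1 : |x μ - y μ| ≤ δ := abs_sub_apply_le x y μ
    have h2 : |x ν - y ν| ≤ δ := abs_sub_apply_le x y ν
    have h3 : |x ν| ≤ 2 := (abs_apply_le_norm x ν).trans hx2
    have h4 : |y μ| ≤ 2 := (abs_apply_le_norm y μ).trans hy2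
    have e : x μ * x ν - y μ * y ν = (x μ - y μ) * x ν + y μ * (x ν - y ν) := by ring
    rw [e]
    calc |(x μ - y μ) * x ν + y μ * (x ν - y ν)| ≤ |(x μ - y μ) * x ν| + |y μ * (x ν - y ν)| := abs_add_le _ _
      _ = |x μ - y μ| * |x ν| + |y μ| * |x ν - y ν| := by rw [abs_mul, abs_mul]
      _ ≤ δ * 2 + 2 * δ := by gcongr
      _ = 4 * δ := by ring
  have hm' : |y μ * y ν| ≤ s' := abs_mul_apply_le_normSq y μ ν
  have hss : |s - s'| ≤ 16 * δ := abs_normSq_sub_le hx2 hy2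
  -- the decomposition
  have e : x μ * x ν / s ^ 2 - y μ * y ν / s' ^ 2
      = (x μ * x ν - y μ * y ν) / s ^ 2 + y μ * y ν * (s' - s) * (s' + s) / (s ^ 2 * s' ^ 2) := by
    field_simp
    ring
  rw [e]
  refine (abs_add_le _ _).trans ?_
  have t1 : |(x μ * x ν - y μ * y ν) / s ^ 2| ≤ 64 * δ := by
    rw [abs_div, abs_of_pos (pow_pos hs0 2), div_le_iff₀ (pow_pos hs0 2)]
    have h16 : 1 / 16 ≤ s ^ 2 := by nlinarith
    nlinarith
  have t2 : |y μ * y ν * (s' - s) * (s' + s) / (s ^ 2 * s' ^ 2)| ≤ 512 * δ := by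
    rw [abs_div, abs_of_pos (by positivity : (0 : ℝ) < s ^ 2 * s' ^ 2), div_le_iff₀ (by positivity), abs_mul,
      abs_mul, abs_of_pos (by linarith : (0 : ℝ) < s' + s), abs_sub_comm s' s]
    -- `|y_μy_ν|·|s − s'|·(s' + s) ≤ s'·(16δ)·(s' + s) ≤ 16δ·32·s²·s'²`
    have step1 : |y μ * y ν| * |s - s'| * (s' + s) ≤ s' * (16 * δ) * (s' + s) := by
      gcongr
    have key : s' + s ≤ 32 * s ^ 2 * s' := by
      have a1 : s ≤ 4 * s ^ 2 := by nlinarith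
      have a2 : 4 * s ^ 2 ≤ 16 * s ^ 2 * s' := by nlinarith [sq_nonneg s]
      have a3 : s' ≤ 16 * s ^ 2 * s' := by nlinarith
      linarith
    have step2 : s' * (16 * δ) * (s' + s) ≤ s' * (16 * δ) * (32 * s ^ 2 * s') := by
      gcongr
    calc |y μ * y ν| * |s - s'| * (s' + s) ≤ s' * (16 * δ) * (32 * s ^ 2 * s') := step1.trans step2
      _ = 512 * δ * (s ^ 2 * s' ^ 2) := by ring
  linarith

/-- **LIPSCHITZ BOUND FOR `T` ON THE SHELL**: `|T(x) − T(y)| ≤ 110592·‖x − y‖` for `1/2 ≤ ‖x‖, ‖y‖ ≤ 2`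
(`T = 24G²`, `|G| ≤ 4`, `|G(x) − G(y)| ≤ 576‖x − y‖`; `24·576·8 = 110592`). [folklore] -/
theorem abs_transverseUnit_sub_le (μ ν : Fin 4) {x y : Fin 4 → ℝ} (hx1 : 1 / 2 ≤ ‖x‖) (hx2 : ‖x‖ ≤ 2)
    (hy1 : 1 / 2 ≤ ‖y‖) (hy2 : ‖y‖ ≤ 2) :
    |transverseUnit μ ν x - transverseUnit μ ν y| ≤ 110592 * ‖x - y‖ := by
  rw [transverseUnit_eq_sq, transverseUnit_eq_sq]
  set G : ℝ := x μ * x ν / normSq x ^ 2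
  set G' : ℝ := y μ * y ν / normSq y ^ 2
  have hG : |G| ≤ 4 := abs_G_le μ ν hx1
  have hG' : |G'| ≤ 4 := abs_G_le μ ν hy1
  have hΔ : |G - G'| ≤ 576 * ‖x - y‖ := abs_G_sub_G_le μ ν hx1 hx2 hy1 hy2
  have hsum : |G + G'| ≤ 8 := (abs_add_le _ _).trans (by linarith)
  have e : 24 * G ^ 2 - 24 * G' ^ 2 = 24 * ((G - G') * (G + G')) := by ring
  rw [e, abs_mul, abs_mul, abs_of_pos (by norm_num : (0 : ℝ) < 24)]
  calc 24 * (|G - G'| * |G + G'|) ≤ 24 * (576 * ‖x - y‖ * 8) := by gcongr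
    _ = 110592 * ‖x - y‖ := by ring

/-- **`transverseUnit μ ν` IS A `HomogKernel` with `A = 24`, `Λ = 110592`** — so the lead's §6/§10 of `Beta.DyadicShell`
apply to it BY NAME. [folklore] -/
theorem homogKernel_transverseUnit (μ ν : Fin 4) : HomogKernel (transverseUnit μ ν) 24 110592 := by
  refine ⟨by norm_num, by norm_num, ?_, ?_, ?_⟩
  · intro t ht x hx
    exact transverseUnit_smul μ ν ht hx
  · intro x hx
    rw [abs_of_nonneg (transverseUnit_nonneg μ ν x)]
    exact transverseUnit_le_of_norm_eq_one μ ν hx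
  · intro x y hx1 hx2 hy1 hy2
    exact abs_transverseUnit_sub_le μ ν hx1 hx2 hy1 hy2

/-- Hence `κ·T` is a `HomogKernel` with constants `|κ|·24`, `|κ|·110592` (`HomogKernel.smul`). [folklore] -/
theorem homogKernel_leadingIntegrand (κ : ℝ) (μ ν : Fin 4) :
    HomogKernel (leadingIntegrand κ μ ν) (|κ| * 24) (|κ| * 110592) :=
  (homogKernel_transverseUnit μ ν).smul κ

/-! ## 3. The sign: a positivity cube, the unit coefficient `I₁ = unitCoeff μ ν > 0`, and `I(κ·T) = κ·I₁` -/

/-- The corner of the positivity cube: `5/4` at the coordinates `μ, ν`, `0` elsewhere. [folklore] -/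
def cubeCorner (μ ν : Fin 4) : Fin 4 → ℝ := fun i => if i = μ ∨ i = ν then 5 / 4 else 0

/-- Values of the corner: `x₀ μ = x₀ ν = 5/4`, and every coordinate lies in `{0, 5/4}`. [folklore] -/
theorem cubeCorner_apply_bounds (μ ν i : Fin 4) : 0 ≤ cubeCorner μ ν i ∧ cubeCorner μ ν i ≤ 5 / 4 := by
  unfold cubeCorner
  split_ifs <;> norm_num

/-- `x₀ μ = 5/4`. [folklore] -/
@[simp] theorem cubeCorner_apply_left (μ ν : Fin 4) : cubeCorner μ ν μ = 5 / 4 := by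
  simp [cubeCorner]

/-- `x₀ ν = 5/4`. [folklore] -/
@[simp] theorem cubeCorner_apply_right (μ ν : Fin 4) : cubeCorner μ ν ν = 5 / 4 := by
  simp [cubeCorner]

/-- The cube `x₀ + [0, 1/2]⁴` lies in the open shell `1 < ‖x‖ ≤ 2`. [folklore] -/
theorem cube_mem_shell (μ ν : Fin 4) (x : Fin 4 → ℝ)
    (hx : ∀ i, cubeCorner μ ν i ≤ x i ∧ x i ≤ cubeCorner μ ν i + 1 / 2) : 1 < ‖x‖ ∧ ‖x‖ ≤ 2 := by
  constructor
  · have h1 : (5 : ℝ) / 4 ≤ x μ := by simpa using (hx μ).1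
    exact lt_of_lt_of_le (by linarith) ((le_abs_self (x μ)).trans (abs_apply_le_norm x μ))
  · refine (pi_norm_le_iff_of_nonneg (by norm_num)).mpr fun i => ?_
    rw [Real.norm_eq_abs, abs_le]
    obtain ⟨h0, h5⟩ := cubeCorner_apply_bounds μ ν i
    obtain ⟨hl, hu⟩ := hx i
    constructor <;> linarith

/-- On the cube, `T ≥ 1/2048` (`(x_μx_ν)² ≥ (5/4)⁴ = 625/256`, `|x|₂² ≤ 4‖x‖² ≤ 16`). [folklore] -/
theorem transverseUnit_ge_on_cube (μ ν : Fin 4) (x : Fin 4 → ℝ)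
    (hx : ∀ i, cubeCorner μ ν i ≤ x i ∧ x i ≤ cubeCorner μ ν i + 1 / 2) : 1 / 2048 ≤ transverseUnit μ ν x := by
  obtain ⟨h1, h2⟩ := cube_mem_shell μ ν x hx
  have hμ : (5 : ℝ) / 4 ≤ x μ := by simpa using (hx μ).1
  have hν : (5 : ℝ) / 4 ≤ x ν := by simpa using (hx ν).1
  have hm : (25 : ℝ) / 16 ≤ x μ * x ν := by nlinarith [mul_nonneg (sub_nonneg.mpr hμ) (sub_nonneg.mpr hν)]
  have hm2 : (625 : ℝ) / 256 ≤ (x μ * x ν) ^ 2 := by nlinarith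
  have hs16 : normSq x ≤ 16 := normSq_le_sixteen h2
  have hs0 : 0 < normSq x := by
    have := quarter_le_normSq (show (1 : ℝ) / 2 ≤ ‖x‖ by linarith)
    linarith
  have hs4 : normSq x ^ 4 ≤ 65536 := by
    calc normSq x ^ 4 ≤ 16 ^ 4 := pow_le_pow_left₀ hs0.le hs16 4
      _ = 65536 := by norm_num
  unfold transverseUnit
  rw [le_div_iff₀ (pow_pos hs0 4)]
  linarith

/-- **EXISTENCE OF THE UNIT COEFFICIENT WITH ITS SIGN**: there is `I₁` with
`DyadicRate (shellSum (T∘toReal)) I₁ (576·(24 + 110592))` and `I₁ ≥ (1/2048)·(1/4)⁴ = 2⁻¹⁹`. [folklore] -/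
theorem exists_unitCoeff (μ ν : Fin 4) :
    ∃ I₁ : ℝ, DyadicRate (shellSum fun w => transverseUnit μ ν (toReal w)) I₁ (576 * (24 + 110592)) ∧
      1 / 524288 ≤ I₁ := by
  obtain ⟨I, hI, _⟩ := windowLog_of_homogKernel (homogKernel_transverseUnit μ ν)
  have h := coeff_pos_of_cube (homogKernel_transverseUnit μ ν) (fun x _ _ => transverseUnit_nonneg μ ν x)
    (by norm_num : (0 : ℝ) < 1 / 2) (by norm_num : (0 : ℝ) < 1 / 2048) (cube_mem_shell μ ν)
    (transverseUnit_ge_on_cube μ ν) hI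
  refine ⟨I, hI, ?_⟩
  have e : (1 : ℝ) / 2048 * (1 / 2 / 2) ^ 4 = 1 / 524288 := by norm_num
  linarith [h.1]

/-- **THE UNIT COEFFICIENT `I₁(μ, ν)`** — the (unique) limit of the dyadic lattice sums
`D(2^j) = Σ_{2^j<‖w‖_∞≤2^{j+1}} 24(w_μw_ν)²/|w|₂⁸`; a real number DEFINED by choice from `exists_unitCoeff`, pinned by
`unitCoeff_unique`.  Its continuum value `2π²·log 2` (for `μ ≠ ν`) is `transverseValue` (§5), NOT proved here. [folklore] -/
def unitCoeff (μ ν : Fin 4) : ℝ := Classical.choose (exists_unitCoeff μ ν)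

/-- The defining rate of `unitCoeff`. [folklore] -/
theorem unitCoeff_rate (μ ν : Fin 4) :
    DyadicRate (shellSum fun w => transverseUnit μ ν (toReal w)) (unitCoeff μ ν) (576 * (24 + 110592)) :=
  (Classical.choose_spec (exists_unitCoeff μ ν)).1

/-- The crude lower bound `2⁻¹⁹ ≤ I₁`. [folklore] -/
theorem unitCoeff_ge (μ ν : Fin 4) : 1 / 524288 ≤ unitCoeff μ ν :=
  (Classical.choose_spec (exists_unitCoeff μ ν)).2

/-- **`0 < I₁`.** [folklore] -/
theorem unitCoeff_pos (μ ν : Fin 4) : 0 < unitCoeff μ ν :=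
  lt_of_lt_of_le (by norm_num) (unitCoeff_ge μ ν)

/-- Uniqueness: ANY rate for the unit structure has limit `I₁` — a consumer may bring a certified value. [folklore] -/
theorem unitCoeff_unique {μ ν : Fin 4} {I C : ℝ} (h : DyadicRate (shellSum fun w => transverseUnit μ ν (toReal w)) I C) :
    I = unitCoeff μ ν :=
  dyadicRate_unique h (unitCoeff_rate μ ν)

/-- **THE COEFFICIENT OF `κ·T` IS `κ·I₁`** (rate `|κ|·576·(24 + 110592)`). [folklore] -/
theorem dyadicRate_leadingIntegrand (κ : ℝ) (μ ν : Fin 4) :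
    DyadicRate (shellSum fun w => leadingIntegrand κ μ ν (toReal w)) (κ * unitCoeff μ ν)
      (|κ| * (576 * (24 + 110592))) :=
  dyadicRate_smul (unitCoeff_rate μ ν) κ

/-- … and it is the only possible limit. [folklore] -/
theorem coeff_eq_mul {κ : ℝ} {μ ν : Fin 4} {I C : ℝ}
    (h : DyadicRate (shellSum fun w => leadingIntegrand κ μ ν (toReal w)) I C) : I = κ * unitCoeff μ ν :=
  dyadicRate_unique h (dyadicRate_leadingIntegrand κ μ ν)

/-- **SIGN TRICHOTOMY**: the coefficient of `κ·T` is positive iff `κ > 0`. [folklore] -/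
theorem coeff_pos_iff {κ : ℝ} {μ ν : Fin 4} {I C : ℝ}
    (h : DyadicRate (shellSum fun w => leadingIntegrand κ μ ν (toReal w)) I C) : 0 < I ↔ 0 < κ := by
  rw [coeff_eq_mul h]
  exact mul_pos_iff_of_pos_right (unitCoeff_pos μ ν)

/-- … zero iff `κ = 0`. [folklore] -/
theorem coeff_eq_zero_iff {κ : ℝ} {μ ν : Fin 4} {I C : ℝ}
    (h : DyadicRate (shellSum fun w => leadingIntegrand κ μ ν (toReal w)) I C) : I = 0 ↔ κ = 0 := by
  rw [coeff_eq_mul h, mul_eq_zero, or_iff_left (unitCoeff_pos μ ν).ne']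

/-- … negative iff `κ < 0`. [folklore] -/
theorem coeff_neg_iff {κ : ℝ} {μ ν : Fin 4} {I C : ℝ}
    (h : DyadicRate (shellSum fun w => leadingIntegrand κ μ ν (toReal w)) I C) : I < 0 ↔ κ < 0 := by
  rw [coeff_eq_mul h]
  constructor
  · intro hI
    by_contra hκ
    exact absurd hI (not_lt.mpr (mul_nonneg (not_lt.mp hκ) (unitCoeff_pos μ ν).le))
  · intro hκ
    exact mul_neg_of_neg_of_pos hκ (unitCoeff_pos μ ν)

/-! ## 4. Consumers modulo (L1)–(L3): the window decomposition with leading kernel `κ·T∘toReal` -/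

section Consumers

variable {β0 : ℕ → ℕ → ℝ} {Ch Cg A₁ c : ℝ} {M : ℕ → ℕ} {κ : ℝ} {μ ν : Fin 4}

/-- **(AF-0-L) FROM THE WINDOW DECOMPOSITION AND `κ ≥ 0`**: slope `κ·I₁/log 2`, explicit `O(1)` `A(κ·I₁)`
(`WindowDecomposition.logGrowthLower` with the rate of §3). [folklore] -/
theorem logGrowthLower_of_window
    (W : WindowDecomposition β0 (fun w => leadingIntegrand κ μ ν (toReal w)) Ch Cg A₁ c M) (hκ : 0 ≤ κ) :
    LogGrowthLower β0 (κ * unitCoeff μ ν / Real.log 2)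
      (WindowDecomposition.constA Ch Cg A₁ c (κ * unitCoeff μ ν)) :=
  W.logGrowthLower (dyadicRate_leadingIntegrand κ μ ν) (mul_nonneg hκ (unitCoeff_pos μ ν).le)

/-- **NO GROWTH WHEN `κ ≤ 0`**: then `β0 L k ≤ 160·Cg + A₁` for all `L ≥ 2` and all `k` (the window sum of `κ·T` is `≤ 0`,
the quintic remainder is `O(1)` by `TransferUV.abs_sum_le_of_quintic`). [folklore] -/
theorem upper_of_nonpos
    (W : WindowDecomposition β0 (fun w => leadingIntegrand κ μ ν (toReal w)) Ch Cg A₁ c M) (hκ : κ ≤ 0) :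
    ∀ L : ℕ, 2 ≤ L → ∀ k : ℕ, β0 L k ≤ 160 * Cg + A₁ := by
  intro L hL k
  obtain ⟨g, hg, hrem⟩ := W.rem L hL k
  have h2 : |∑ w ∈ annulus 4 0 (M L), g w| ≤ 160 * Cg := TransferUV.abs_sum_le_of_quintic W.nonneg hg
  have h1 : ∑ w ∈ annulus 4 0 (M L), leadingIntegrand κ μ ν (toReal w) ≤ 0 :=
    Finset.sum_nonpos fun w _ => mul_nonpos_of_nonpos_of_nonneg hκ (transverseUnit_nonneg μ ν _)
  rw [Finset.sum_add_distrib] at hrem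
  have e3 := (abs_le.mp hrem).2
  have e2 := (abs_le.mp h2).2
  linarith

/-- **THE DICHOTOMY — (AF-0-L) HOLDS IFF `κ > 0`.**  Under the window decomposition with leading kernel `κ·T∘toReal`:
`(∃ b > 0, ∃ A, LogGrowthLower β0 b A) ↔ 0 < κ`.  (`⇐`: §3 + `logGrowthLower_of_window`; `⇒`: a positive slope contradicts
the uniform upper bound of `upper_of_nonpos` at `L = L₁(b, A, ·)` of `Beta.LargeL`.)  The sign question of the β sub-cell is
the sign of ONE scalar. [folklore] -/
theorem af0L_iff_pos (W : WindowDecomposition β0 (fun w => leadingIntegrand κ μ ν (toReal w)) Ch Cg A₁ c M) :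
    (∃ b A : ℝ, 0 < b ∧ LogGrowthLower β0 b A) ↔ 0 < κ := by
  constructor
  · rintro ⟨b, A, hb, h⟩
    by_contra hκ
    have hup := upper_of_nonpos W (not_lt.mp hκ)
    set b₀ : ℝ := (160 * Cg + A₁ + 1) / 2 with hb₀
    have hL2 : 2 ≤ L₁ b A b₀ := two_le_L₁ b A b₀
    have hlog : (A + 2 * b₀) / b ≤ Real.log (L₁ b A b₀ : ℕ) := div_le_log_of_L₁_le le_rfl
    rw [div_le_iff₀ hb] at hlog
    have h1 := h (L₁ b A b₀) hL2 0
    have h2 := hup (L₁ b A b₀) hL2 0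
    have e : 2 * b₀ = 160 * Cg + A₁ + 1 := by rw [hb₀]; ring
    nlinarith
  · intro hκ
    exact ⟨_, _, div_pos (mul_pos hκ (unitCoeff_pos μ ν)) (Real.log_pos (by norm_num)),
      logGrowthLower_of_window W hκ.le⟩

variable {b₀ : ℝ} {L : ℕ} {β : HBeta} (S : B12Beta.OneLoopSplit β)

/-- (AF-0) at ALL scales for the construction with blocking factor `L ≥ L₁(κ·I₁/log 2, A(κ·I₁), b₀)`, from the window
decomposition with leading kernel `κ·T∘toReal` and `κ > 0`. [folklore] -/
theorem af0_all_of_window (W : WindowDecomposition β0 (fun w => leadingIntegrand κ μ ν (toReal w)) Ch Cg A₁ c M)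
    (hκ : 0 < κ)
    (hL : L₁ (κ * unitCoeff μ ν / Real.log 2) (WindowDecomposition.constA Ch Cg A₁ c (κ * unitCoeff μ ν)) b₀ ≤ L)
    (hS : ∀ k, S.β0 k = β0 L k) : ∀ k, 2 * b₀ ≤ S.β0 k :=
  LargeLWindow.af0_all S W (dyadicRate_leadingIntegrand κ μ ν) (mul_pos hκ (unitCoeff_pos μ ν)) hL hS

/-- **THEOREM 2 AS PRINTED from: the window decomposition with leading kernel `κ·T∘toReal`, `κ > 0`, `L ≥ L₁`, and the
printed-type inputs of `Beta.LargeL`** (`LargeLWindow.thm2Printed` with `I = κ·I₁ > 0` supplied by §3).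
[cite: Balaban1987RG1, Thm 2 p.259 with (0.31)] -/
theorem thm2Printed_of_window (W : WindowDecomposition β0 (fun w => leadingIntegrand κ μ ν (toReal w)) Ch Cg A₁ c M)
    (hκ : 0 < κ)
    (hL : L₁ (κ * unitCoeff μ ν / Real.log 2) (WindowDecomposition.constA Ch Cg A₁ c (κ * unitCoeff μ ν)) b₀ ≤ L)
    (hS : ∀ k, S.β0 k = β0 L k) {γ₀ r β' : ℝ} (hγ₀ : 0 < γ₀) (hb₀ : 0 < b₀) (hrem : RemainderConst S γ₀ r) (hr : r ≤ b₀)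
    (hup : BetaUpperH β' γ₀ β) (hlo : ∀ k, ∀ v ∈ Box γ₀ k, -β' ≤ β k v) (hcont : BetaContH γ₀ β)
    {C : B12.Construction} (hgen : ForwardGenerated C β) {Lr : ℝ} (hLr : 1 < Lr) : B12.Thm2Printed C Lr :=
  LargeLWindow.thm2Printed S W (dyadicRate_leadingIntegrand κ μ ν) (mul_pos hκ (unitCoeff_pos μ ν)) hL hS hγ₀ hb₀ hrem hr
    hup hlo hcont hgen hLr

/-- Endpoint existence ([Balaban1987RG1] Thm 2, first sentence) from the same inputs.
[cite: Balaban1987RG1, Thm 2 p.259 (first sentence)] -/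
theorem endpointExistence_of_window
    (W : WindowDecomposition β0 (fun w => leadingIntegrand κ μ ν (toReal w)) Ch Cg A₁ c M) (hκ : 0 < κ)
    (hL : L₁ (κ * unitCoeff μ ν / Real.log 2) (WindowDecomposition.constA Ch Cg A₁ c (κ * unitCoeff μ ν)) b₀ ≤ L)
    (hS : ∀ k, S.β0 k = β0 L k) {γ₀ r β' : ℝ} (hγ₀ : 0 < γ₀) (hb₀ : 0 < b₀) (hrem : RemainderConst S γ₀ r) (hr : r ≤ b₀)
    (hup : BetaUpperH β' γ₀ β) (hlo : ∀ k, ∀ v ∈ Box γ₀ k, -β' ≤ β k v) (hcont : BetaContH γ₀ β)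
    {C : B12.Construction} (hgen : ForwardGenerated C β) : EndpointExistence C :=
  LargeLWindow.endpointExistence S W (dyadicRate_leadingIntegrand κ μ ν) (mul_pos hκ (unitCoeff_pos μ ν)) hL hS hγ₀ hb₀
    hrem hr hup hlo hcont hgen

end Consumers

/-! ## 5. VALUE and TRANSFER dictionary: `2π²·log 2`, `kappaBal N = 11N²/(24π⁴)`, and the slope `stepBal N L / log L`

Definitions of real numbers and arithmetic only.  `transverseValue = ∫_{1<‖x‖_∞≤2} T(x) dx = log 2 · ∫_{S³} 24ω_μ²ω_ν² dσ(ω)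
= log 2 · 24 · (2π²/24)` (`μ ≠ ν`; the angular integral of a degree-`−4` homogeneous function over any norm-shell `{a < N ≤ b}`
is `log(b/a)` times its `S³`-integral) is the expected value of `unitCoeff μ ν` (Riemann sums `2^{−4j}·#` over the dyadic
shells converge to the shell integral by the Lipschitz bound of §2); the identification `unitCoeff μ ν = transverseValue` is
proved on paper and reproduced by two numerical engines in AN3.md v3 §6 — in THIS file it is only a hypothesis `hval`. -/

/-- The continuum shell integral of `T` (`μ ≠ ν`): `2π²·log 2 ≈ 13.682`. A DEFINED real number. [folklore] -/
def transverseValue : ℝ := 2 * Real.pi ^ 2 * Real.log 2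

/-- `transverseValue > 0`. [folklore] -/
theorem transverseValue_pos : 0 < transverseValue := by
  unfold transverseValue
  have := Real.pi_pos
  have := Real.log_pos (by norm_num : (1 : ℝ) < 2)
  positivity

/-- **THE TRANSFER SCALAR** `kappaBal N := 11N²/(24π⁴)`: BY DEFINITION the unique `κ` whose (AF-0-L) slope
`κ·transverseValue/log 2 = 2π²κ` equals `stepBal N L / log L = 11N²/(12π²)` (`slope_kappaBal`).  In the continuum
background-field dictionary it reads `2N · 2b₀ / (2π²)` with `b₀ = 11N/(48π²) = (11N/3)/(16π²)` (`B12Normalization.b0`) —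
Bałaban's `2N` (`B12Normalization.stepBal = 2N·stepYM`) times the textbook change `2b₀` of `1/g²_YM` per `log L`
(`stepYM = 2b₀·log L`), divided by the angular factor `2π² = |S³|`; whether Bałaban's leading window kernel carries THIS
scalar is the located unprinted identification (GAPS G-beta-an3-4), asserted nowhere. [folklore] -/
def kappaBal (N : ℝ) : ℝ := 11 * N ^ 2 / (24 * Real.pi ^ 4)

/-- `kappaBal N > 0` for `N ≠ 0`. [folklore] -/
theorem kappaBal_pos {N : ℝ} (hN : N ≠ 0) : 0 < kappaBal N := by
  unfold kappaBal
  have := Real.pi_pos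
  have : 0 < N ^ 2 := by positivity
  positivity

/-- **THE SLOPE IDENTITY**: `kappaBal N · transverseValue / log 2 · log L = stepBal N L` (pure arithmetic against
`B12Normalization.stepBal_eq`). [folklore] -/
theorem slope_kappaBal (N L : ℝ) :
    kappaBal N * transverseValue / Real.log 2 * Real.log L = B12Normalization.stepBal N L := by
  rw [B12Normalization.stepBal_eq]
  unfold kappaBal transverseValue
  have hπ : Real.pi ≠ 0 := Real.pi_pos.ne'
  have hlog : Real.log 2 ≠ 0 := (Real.log_pos (by norm_num : (1 : ℝ) < 2)).ne'
  field_simp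
  ring

/-- `κ·transverseValue/log 2 = 2π²κ`. [folklore] -/
theorem slope_of_value (κ : ℝ) : κ * transverseValue / Real.log 2 = 2 * Real.pi ^ 2 * κ := by
  unfold transverseValue
  have hlog : Real.log 2 ≠ 0 := (Real.log_pos (by norm_num : (1 : ℝ) < 2)).ne'
  field_simp

/-- **CONSUMER OF THE VALUE**: IF the unit coefficient has its continuum value (`hval`, paper-proved / numerically
reproduced, NOT kernel-proved), the (AF-0-L) slope produced by the window decomposition with leading kernel `κ·T∘toReal`,
`κ ≥ 0`, is `2π²κ`; with `κ = kappaBal N` it is `stepBal N L / log L` (`slope_kappaBal`). [folklore] -/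
theorem logGrowthLower_of_value {β0 : ℕ → ℕ → ℝ} {Ch Cg A₁ c : ℝ} {M : ℕ → ℕ} {κ : ℝ} {μ ν : Fin 4}
    (W : WindowDecomposition β0 (fun w => leadingIntegrand κ μ ν (toReal w)) Ch Cg A₁ c M) (hκ : 0 ≤ κ)
    (hval : unitCoeff μ ν = transverseValue) :
    LogGrowthLower β0 (2 * Real.pi ^ 2 * κ) (WindowDecomposition.constA Ch Cg A₁ c (κ * transverseValue)) := by
  have h := logGrowthLower_of_window W hκ
  rw [hval, slope_of_value] at h
  exact h

/-- The same with `κ = kappaBal N`: slope `2π²·kappaBal N = 11N²/(12π²)`, i.e. `b·log L = stepBal N L`. [folklore] -/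
theorem logGrowthLower_stepBal {β0 : ℕ → ℕ → ℝ} {Ch Cg A₁ c : ℝ} {M : ℕ → ℕ} {N : ℝ} {μ ν : Fin 4}
    (W : WindowDecomposition β0 (fun w => leadingIntegrand (kappaBal N) μ ν (toReal w)) Ch Cg A₁ c M) (hN : N ≠ 0)
    (hval : unitCoeff μ ν = transverseValue) :
    ∀ L : ℕ, 2 ≤ L → ∀ k : ℕ,
      B12Normalization.stepBal N L - WindowDecomposition.constA Ch Cg A₁ c (kappaBal N * transverseValue) ≤ β0 L k := by
  intro L hL k
  have h := logGrowthLower_of_value W (kappaBal_pos hN).le hval L hL k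
  rw [← slope_kappaBal N L, slope_of_value]
  exact h

/-! ## 6. Non-vacuity of §4's hypothesis: the model `β⁰(L, k) := Σ_{0<‖w‖_∞≤L} κ·T(w)` admits the window decomposition -/

namespace Witness

/-- The model coefficient family built from the leading integrand itself (no remainder, no `k`-dependence). [folklore] -/
def betaModel (κ : ℝ) (μ ν : Fin 4) (L : ℕ) (_k : ℕ) : ℝ :=
  ∑ w ∈ annulus 4 0 L, leadingIntegrand κ μ ν (toReal w)

/-- It admits the window decomposition with `h = κ·T∘toReal`, `Ch = |κ|·(24 + 110592)`, `g = 0`, `ρ = 0`, `M = id`,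
`c = 1`. [folklore] -/
theorem windowDecomposition_model (κ : ℝ) (μ ν : Fin 4) :
    WindowDecomposition (betaModel κ μ ν) (fun w => leadingIntegrand κ μ ν (toReal w)) (|κ| * 24 + |κ| * 110592) 0 0 1
      id where
  data := dyadicData_of_homogKernel (homogKernel_leadingIntegrand κ μ ν)
  nonneg := le_rfl
  one_le := le_rfl
  window L hL := ⟨by show 1 ≤ L; omega, by simp⟩
  rem L _ k := ⟨fun _ => 0, fun r w _ => by simp only [abs_zero]; positivity, by simp [betaModel]⟩

/-- Hence for the model: (AF-0-L) with a positive slope holds iff `κ > 0` — both directions of `af0L_iff_pos` are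
exercised on an inhabitant. [folklore] -/
theorem af0L_model_iff (κ : ℝ) (μ ν : Fin 4) :
    (∃ b A : ℝ, 0 < b ∧ LogGrowthLower (betaModel κ μ ν) b A) ↔ 0 < κ :=
  af0L_iff_pos (windowDecomposition_model κ μ ν)

end Witness

end

end Literature.MathematicalPhysics.QuantumFieldTheory.Balaban1983to89.Beta.LeadingCoefficient
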